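import Summits.BirchSwinnertonDyer.BirchSwinnertonDyer.Theorems.BiquadraticEisensteinDescentHeegnerTwistCouplingInSupplySymbolicMonskyEvenKernelParity
import HarnessLib

set_option linter.dupNamespace false -- `Summit.BirchSwinnertonDyer.BirchSwinnertonDyer.Theorems.…` (summit = sub)
set_option autoImplicit false

/-!
# Crux `HeegnerTwistCouplingInSupply` (stmt-BirchSwinnertonDyer-21381) — EVEN UNIVERSALITY ON THE FAMILY `(2/P_b) = +1`: every even base
# `2·P₀⋯P_k` with all `P_b ≡ ±1 (mod 8)` owns a pattern-free Heegner recipe at `t₀^{ev}` via the design `δ = 1` — NO exceptional class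

Route `BiquadraticEisensteinDescent` (cell `pub/bsd-wall`, width seat `bsd-wall-cm-bed-w3` g24; `--supports` 21381, helper). The even one-stage door
(EVEN THEOREM A, p747329 / p751399) has exceptional classes in general (`even_universality_fails`, p750799: the first at `K = 5` needs four primes
`≡ 5 (mod 8)`). This file proves that on the family where `2` is a square modulo every odd base prime — `d = 0`, i.e. all `P_b ≡ ±1 (mod 8)`, with an
odd number `≡ 7 (mod 8)` for root number `−1` — there is NO exceptional class: the single design `δ = 1` works for every base and every `k`.
* ★ `mem_evenVirtualKernel_iff_of_negTwo_false` — for such bases `(u,v) ∈ 𝒦_ev ⟺ L(u+v) = 0 ∧ ⟨m,u+v⟩ = 0 ∧ Lᵀv = 0` (`L` the Laplacian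
  `(Lx)_i = Σ_j [(P_j/P_i) = −1](x_j + x_i)`, `Lᵀ` written out by quadratic reciprocity; the middle condition is forced by the column sums of `L`);
* ★★★ `exists_patternFree_even_design_of_negTwo_false` — cells `c₁ :: rest`, `|rest| = τ₀^{ev} = (dim 𝒦_ev + 1)/2`, with `heegnerK` and `det M_even = 1`
  for EVERY mutual pattern. Proof: `dim 𝒦_ev ≥ 2 dim ker L − 1` (the pairs `(u,0)`, `u ∈ ker L ∩ m^⊥`, and `(v,v)`, `v ∈ ker Lᵀ`; `rank L = rank Lᵀ`),
  and for `δ = 1`: `W_ev(1) ∩ (V×0) ⊆ ker L × 0`, `W_ev(1) ∩ (0×V) ⊆ 0 × ker L`, `W_ev(1) ∩ Δ ⊆ {(v,v) : v ∈ ker Lᵀ}` (using `⟨m,1⟩ = μ = 1`), and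
  `(1,0) ∉ T_1(𝒦_ev)`; then EVEN THEOREM A with `hdim` discharged (`exists_patternFree_even_design_pencil_of_odd`, p751399).
Numerics (memo EVEN-EXCEPTIONAL-CLASS-w3g24 §2c): exhaustive `K ≤ 5` (16 933 bases) and 289 214 sampled bases `K ≤ 12` of the family — δ = 1 good in all.

HONEST FRAMING: RUNG-LEVEL corner layer (even congruent `j = 1728` families `E_{2n₀}`); an existence theorem about Monsky matrices — instances of the crux
still need located primes (`RealisesK.cruxOn_even_of_BT_of_forall`) and the print input (Burungale–Tian); the crux as stated (C⁺), its registered stubs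
and BSD are NOT touched; nothing is closed. THEOREMS ONLY (no `def`, no instance, no notation).
Reference: [HeathBrown1994] D. R. Heath-Brown, Invent. Math. 118 (1994) 331–370, appendix (Monsky), typescript p. 41 L20–L36.
-/

namespace Summit.BirchSwinnertonDyer.BirchSwinnertonDyer.Theorems.SymbolicMonsky

section NegTwoTrivial

open Module Matrix

variable {k : ℕ} (base : SymbData (k + 1))

/-- Row of the Laplacian block: `(L y)_i = Σ_j [(P_j/P_i) = −1](y_j + y_i)`. -/
private theorem lap_mulVec (y : Fin (k + 1) → ZMod 2) (i : Fin (k + 1)) :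
    ((Matrix.of fun i j : Fin (k + 1) => bz (base.neg i j) + if i = j then (∑ l, bz (base.neg i l)) else 0) *ᵥ y) i =
      ∑ j, bz (base.neg i j) * (y j + y i) := by
  simp only [mulVec, dotProduct, Matrix.of_apply]
  have e1 : (∑ j, (bz (base.neg i j) + if i = j then (∑ l, bz (base.neg i l)) else 0) * y j) =
      (∑ j, bz (base.neg i j) * y j) + ∑ j, (if i = j then (∑ l, bz (base.neg i l)) * y j else 0) := by
    rw [← Finset.sum_add_distrib]
    refine Finset.sum_congr rfl fun j _ => ?_
    split_ifs <;> ring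
  have e2 : (∑ j, bz (base.neg i j) * (y j + y i)) = (∑ j, bz (base.neg i j) * y j) + (∑ l, bz (base.neg i l)) * y i := by
    rw [Finset.sum_mul, ← Finset.sum_add_distrib]
    exact Finset.sum_congr rfl fun j _ => by ring
  rw [e1, Finset.sum_ite_eq, e2]
  simp only [Finset.mem_univ, if_true]

/-- Row of the transposed Laplacian (quadratic reciprocity): `(Lᵀ x)_i = Σ_j [(P_j/P_i) = −1](x_j + x_i) + m_i ⟨m,x⟩ + m_i x_i`. -/
private theorem lapT_mulVec (x : Fin (k + 1) → ZMod 2) (i : Fin (k + 1)) :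
    ((Matrix.of fun i j : Fin (k + 1) => bz (base.neg i j) + if i = j then (∑ l, bz (base.neg i l)) else 0)ᵀ *ᵥ x) i =
      (∑ j, bz (base.neg i j) * (x j + x i)) + bz (negNegOne (base.cls i)) * (∑ j, bz (negNegOne (base.cls j)) * x j) +
        bz (negNegOne (base.cls i)) * x i := by
  have h2 : ∀ x : ZMod 2, x + x = 0 := by decide
  have hsq : ∀ x : ZMod 2, x * x = x := by decide
  simp only [mulVec, dotProduct, transpose_apply, Matrix.of_apply]
  -- pointwise reciprocity `n_ji x_j = n_ij x_j + [j ≠ i] m_i m_j x_j`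
  have hpt : ∀ j, (bz (base.neg j i) + if j = i then (∑ l, bz (base.neg j l)) else 0) * x j =
      bz (base.neg i j) * x j + bz (negNegOne (base.cls i)) * bz (negNegOne (base.cls j)) * x j +
        (if j = i then ((∑ l, bz (base.neg i l)) + bz (negNegOne (base.cls i))) * x j else 0) := by
    intro j
    by_cases hji : j = i
    · subst hji
      rw [if_pos rfl, if_pos rfl]
      linear_combination (-(hsq (bz (negNegOne (base.cls j)))) - h2 (bz (negNegOne (base.cls j)))) * x j
    · have hij : i ≠ j := fun h => hji h.symm
      rw [if_neg hji, if_neg hji, base.bz_neg_swap hij, bz_and_mul]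
      ring
  rw [Finset.sum_congr rfl fun j _ => hpt j, Finset.sum_add_distrib, Finset.sum_add_distrib, Finset.sum_ite_eq' Finset.univ i]
  simp only [Finset.mem_univ, if_true]
  have e2 : (∑ j, bz (base.neg i j) * (x j + x i)) = (∑ j, bz (base.neg i j) * x j) + (∑ l, bz (base.neg i l)) * x i := by
    rw [Finset.sum_mul, ← Finset.sum_add_distrib]
    exact Finset.sum_congr rfl fun j _ => by ring
  have e3 : (∑ j, bz (negNegOne (base.cls i)) * bz (negNegOne (base.cls j)) * x j) =
      bz (negNegOne (base.cls i)) * ∑ j, bz (negNegOne (base.cls j)) * x j := by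
    rw [Finset.mul_sum]
    exact Finset.sum_congr rfl fun j _ => by ring
  rw [e2, e3]
  ring

/-- Column sums of the Laplacian: `Σ_i Σ_j [(P_j/P_i) = −1](y_j + y_i) = (1 + μ)⟨m,y⟩`. -/
private theorem sum_lap_eq (y : Fin (k + 1) → ZMod 2) :
    (∑ i, ∑ j, bz (base.neg i j) * (y j + y i)) =
      (1 + ∑ b, bz (negNegOne (base.cls b))) * ∑ j, bz (negNegOne (base.cls j)) * y j := by
  have h2 : ∀ x : ZMod 2, x + x = 0 := by decide
  have hsq : ∀ x : ZMod 2, x * x = x := by decide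
  have e1 : (∑ i, ∑ j, bz (base.neg i j) * (y j + y i)) = ∑ i, ∑ j, (bz (base.neg j i) + bz (base.neg i j)) * y i := by
    have : (∑ i, ∑ j, bz (base.neg i j) * (y j + y i)) = (∑ i, ∑ j, bz (base.neg i j) * y j) + ∑ i, ∑ j, bz (base.neg i j) * y i := by
      rw [← Finset.sum_add_distrib]
      refine Finset.sum_congr rfl fun i _ => ?_
      rw [← Finset.sum_add_distrib]
      exact Finset.sum_congr rfl fun j _ => by ring
    rw [this, Finset.sum_comm, ← Finset.sum_add_distrib]
    refine Finset.sum_congr rfl fun i _ => ?_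
    rw [← Finset.sum_add_distrib]
    exact Finset.sum_congr rfl fun j _ => by ring
  have e2 : ∀ i, (∑ j, (bz (base.neg j i) + bz (base.neg i j)) * y i) =
      (∑ j, bz (negNegOne (base.cls i)) * bz (negNegOne (base.cls j)) * y i) + bz (negNegOne (base.cls i)) * y i := by
    intro i
    have hpt : ∀ j, (bz (base.neg j i) + bz (base.neg i j)) * y i =
        bz (negNegOne (base.cls i)) * bz (negNegOne (base.cls j)) * y i + (if j = i then bz (negNegOne (base.cls i)) * y i else 0) := by
      intro j
      by_cases hji : j = i
      · subst hji
        rw [if_pos rfl]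
        linear_combination (h2 (bz (base.neg j j))) * y j - (hsq (bz (negNegOne (base.cls j)))) * y j -
          h2 (bz (negNegOne (base.cls j)) * y j)
      · have hij : i ≠ j := fun h => hji h.symm
        rw [if_neg hji, base.bz_neg_swap hij, bz_and_mul]
        linear_combination (h2 (bz (base.neg i j))) * y i
    rw [Finset.sum_congr rfl fun j _ => hpt j, Finset.sum_add_distrib, Finset.sum_ite_eq' Finset.univ i]
    simp only [Finset.mem_univ, if_true]
  rw [e1, Finset.sum_congr rfl fun i _ => e2 i, Finset.sum_add_distrib, add_mul, one_mul, Finset.mul_sum]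
  have e3 : ∀ i, (∑ j, bz (negNegOne (base.cls i)) * bz (negNegOne (base.cls j)) * y i) =
      (∑ b, bz (negNegOne (base.cls b))) * (bz (negNegOne (base.cls i)) * y i) := by
    intro i
    rw [Finset.sum_mul]
    exact Finset.sum_congr rfl fun j _ => by ring
  rw [Finset.sum_congr rfl fun i _ => e3 i, add_comm]

/-- ★ **The even virtual kernel when every base prime is `≡ ±1 (mod 8)`.** If `(2/P_b) = +1` for all `b` and `μ` is odd, then
`(u, v) ∈ 𝒦_ev ⟺ L(u+v) = 0 ∧ ⟨m, u+v⟩ = 0 ∧ Lᵀ v = 0`. -/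
theorem mem_evenVirtualKernel_iff_of_negTwo_false (hd : ∀ b, negTwo (base.cls b) = false)
    (hμ : (∑ b, bz (negNegOne (base.cls b))) = 1) (p : (Fin (k + 1) → ZMod 2) × (Fin (k + 1) → ZMod 2)) :
    p ∈ base.evenVirtualKernel ↔
      ((∀ i, (∑ j, bz (base.neg i j) * (p.1 j + p.1 i)) + ∑ j, bz (base.neg i j) * (p.2 j + p.2 i) = 0) ∧
       ((∑ j, bz (negNegOne (base.cls j)) * p.1 j) + ∑ j, bz (negNegOne (base.cls j)) * p.2 j = 0) ∧
       (∀ i, (∑ j, bz (base.neg i j) * (p.2 j + p.2 i)) + bz (negNegOne (base.cls i)) * (∑ j, bz (negNegOne (base.cls j)) * p.2 j) +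
          bz (negNegOne (base.cls i)) * p.2 i = 0)) := by
  have h2 : ∀ x : ZMod 2, x + x = 0 := by decide
  have hd0 : ∀ b, bz (negTwo (base.cls b)) = 0 := fun b => by rw [hd b]; rfl
  rw [mem_evenVirtualKernel_iff]
  simp only [hd0, zero_mul, add_zero, zero_add]
  constructor
  · rintro ⟨hE1, hE2⟩
    -- sum the second equations: `⟨m,v⟩ + ⟨m,u⟩ = 0`
    have hs : (∑ i, ((∑ j, bz (base.neg i j) * (p.2 j + p.2 i)) + bz (negNegOne (base.cls i)) * p.2 i +
        bz (negNegOne (base.cls i)) * ∑ j, bz (negNegOne (base.cls j)) * p.1 j)) = 0 :=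
      Finset.sum_eq_zero fun i _ => hE2 i
    rw [Finset.sum_add_distrib, Finset.sum_add_distrib, sum_lap_eq, hμ, ← Finset.sum_mul, hμ] at hs
    have hM : (∑ j, bz (negNegOne (base.cls j)) * p.1 j) + ∑ j, bz (negNegOne (base.cls j)) * p.2 j = 0 := by
      linear_combination hs - h2 (∑ j, bz (negNegOne (base.cls j)) * p.2 j)
    refine ⟨fun i => ?_, hM, fun i => ?_⟩
    · have e1 := hE1 i
      have e2 := hE2 i
      linear_combination e1 + e2 - h2 (bz (negNegOne (base.cls i)) * p.2 i) -
        h2 (bz (negNegOne (base.cls i)) * ∑ j, bz (negNegOne (base.cls j)) * p.1 j)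
    · have e2 := hE2 i
      linear_combination e2 + bz (negNegOne (base.cls i)) * hM -
        h2 (bz (negNegOne (base.cls i)) * ∑ j, bz (negNegOne (base.cls j)) * p.1 j)
  · rintro ⟨hL, hM, hT⟩
    refine ⟨fun i => ?_, fun i => ?_⟩
    · have e1 := hL i
      have e3 := hT i
      linear_combination e1 - e3 + bz (negNegOne (base.cls i)) * hM + h2 (bz (negNegOne (base.cls i)) * p.2 i)
    · have e3 := hT i
      linear_combination e3 - bz (negNegOne (base.cls i)) * hM + h2 (bz (negNegOne (base.cls i)) * ∑ j, bz (negNegOne (base.cls j)) * p.1 j)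

/-- ★★★ **EVEN UNIVERSALITY ON THE FAMILY `(2/P_b) = +1` — no exceptional class.** Let `n = 2·P₀⋯P_k` with EVERY `P_b ≡ ±1 (mod 8)` and an odd
number of `P_b ≡ 7 (mod 8)` (root number `−1`). Then the design `δ = 1` satisfies ALL hypotheses of EVEN THEOREM A: there are cells `c₁ :: rest`,
`|rest| = τ₀^{ev} = (dim 𝒦_ev + 1)/2`, with `heegnerK` and Monsky's even matrix invertible for EVERY mutual pattern — a pattern-free Heegner recipe
with `τ₀^{ev} + 1` auxiliary primes, for EVERY base of the family and every `k`. Proof: by `mem_evenVirtualKernel_iff_of_negTwo_false`,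
`𝒦_ev = {(u,v) : u+v ∈ ker L ∩ m^⊥, v ∈ ker Lᵀ}`, so `dim 𝒦_ev ≥ 2·dim ker L − 1` (the pairs `(u,0)`, `u ∈ ker L ∩ m^⊥`, and `(v,v)`, `v ∈ ker Lᵀ`;
`rank L = rank Lᵀ`), while `W_ev(1) ∩ (V×0) ⊆ ker L × 0`, `W_ev(1) ∩ (0×V) ⊆ 0 × ker L`, `W_ev(1) ∩ Δ ⊆ {(v,v) : v ∈ ker Lᵀ}` and `(1,0) ∉ T_1(𝒦_ev)`
(as `⟨m,1⟩ = μ = 1`). Contrast: on the families `(2/P_b) = −1` the vertical exceptional class exists (`even_universality_fails`, p750799).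
[cite: HeathBrown1994SelmerCongruentII, Appendix (Monsky), typescript p. 41 L20–L36] -/
theorem exists_patternFree_even_design_of_negTwo_false (hd : ∀ b, negTwo (base.cls b) = false)
    (hμ : (∑ b, bz (negNegOne (base.cls b))) = 1) :
    ∃ (c₁ : AuxCell) (rest : List AuxCell), rest.length = (finrank (ZMod 2) ↥base.evenVirtualKernel + 1) / 2 ∧
      heegnerK base (c₁ :: rest) = true ∧ ∀ pat : ℕ → ℕ → Bool, (dataK base (c₁ :: rest) pat).monskyEvenS.det = 1 := by
  have h2 : ∀ x : ZMod 2, x + x = 0 := by decide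
  have h11 : (1 : ZMod 2) + 1 = 0 := h2 1
  -- the Laplacian and its transpose
  set Lm : Matrix (Fin (k + 1)) (Fin (k + 1)) (ZMod 2) := Matrix.of fun i j : Fin (k + 1) => bz (base.neg i j) +
      if i = j then (∑ l, bz (base.neg i l)) else 0 with hLm
  set kerL : Submodule (ZMod 2) (Fin (k + 1) → ZMod 2) := LinearMap.ker Lm.mulVecLin with hkerL
  set kerLt : Submodule (ZMod 2) (Fin (k + 1) → ZMod 2) := LinearMap.ker Lmᵀ.mulVecLin with hkerLt
  have memL : ∀ y, y ∈ kerL ↔ ∀ i, (∑ j, bz (base.neg i j) * (y j + y i)) = 0 := by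
    intro y
    rw [hkerL, LinearMap.mem_ker, mulVecLin_apply]
    constructor
    · intro h i; have := congrFun h i; rwa [lap_mulVec] at this
    · intro h; funext i; rw [lap_mulVec]; exact h i
  have memLt : ∀ x, x ∈ kerLt ↔ ∀ i, (∑ j, bz (base.neg i j) * (x j + x i)) +
      bz (negNegOne (base.cls i)) * (∑ j, bz (negNegOne (base.cls j)) * x j) + bz (negNegOne (base.cls i)) * x i = 0 := by
    intro x
    rw [hkerLt, LinearMap.mem_ker, mulVecLin_apply]
    constructor
    · intro h i; have := congrFun h i; rwa [lapT_mulVec] at this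
    · intro h; funext i; rw [lapT_mulVec]; exact h i
  -- `dim ker Lᵀ = dim ker L`
  have hrank : finrank (ZMod 2) ↥kerLt = finrank (ZMod 2) ↥kerL := by
    have r1 := LinearMap.finrank_range_add_finrank_ker Lm.mulVecLin
    have r2 := LinearMap.finrank_range_add_finrank_ker Lmᵀ.mulVecLin
    have rt : Lmᵀ.rank = Lm.rank := rank_transpose Lm
    change Lmᵀ.rank + _ = _ at r2
    change Lm.rank + _ = _ at r1
    rw [hkerLt, hkerL]
    omega
  set t := finrank (ZMod 2) ↥kerL with ht
  -- the functional `⟨m, ·⟩` and its kernel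
  let φ : (Fin (k + 1) → ZMod 2) →ₗ[ZMod 2] ZMod 2 := ∑ j, bz (negNegOne (base.cls j)) • LinearMap.proj j
  have hφ : ∀ u, φ u = ∑ j, bz (negNegOne (base.cls j)) * u j := by
    intro u
    simp only [φ, LinearMap.coe_sum, Finset.sum_apply, LinearMap.smul_apply, LinearMap.coe_proj, Function.eval,
      smul_eq_mul]
  have hφ1 : φ (fun _ => 1) = 1 := by rw [hφ]; simpa using hμ
  -- LOWER BOUND `2t ≤ dim 𝒦_ev + 1`
  have hlow : 2 * t ≤ finrank (ZMod 2) ↥base.evenVirtualKernel + 1 := by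
    -- `H = {(u,0) : u ∈ ker L ∩ ker φ}`, `D = {(v,v) : v ∈ ker Lᵀ}`
    set H := (kerL ⊓ LinearMap.ker φ).map (LinearMap.inl (ZMod 2) (Fin (k + 1) → ZMod 2) (Fin (k + 1) → ZMod 2)) with hH
    set D := kerLt.map ((LinearMap.id : (Fin (k + 1) → ZMod 2) →ₗ[ZMod 2] (Fin (k + 1) → ZMod 2)).prod LinearMap.id) with hD
    have hHle : H ≤ base.evenVirtualKernel := by
      rintro p hp
      obtain ⟨u, hu, rfl⟩ := Submodule.mem_map.1 hp
      obtain ⟨huL, huφ⟩ := Submodule.mem_inf.1 hu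
      rw [memL] at huL
      rw [LinearMap.mem_ker, hφ] at huφ
      rw [mem_evenVirtualKernel_iff_of_negTwo_false base hd hμ]
      refine ⟨fun i => ?_, ?_, fun i => ?_⟩
      · simp only [LinearMap.inl_apply, Pi.zero_apply, add_zero, mul_zero, Finset.sum_const_zero]; exact huL i
      · simp only [LinearMap.inl_apply, Pi.zero_apply, mul_zero, Finset.sum_const_zero, add_zero]; exact huφ
      · simp only [LinearMap.inl_apply, Pi.zero_apply, add_zero, mul_zero, Finset.sum_const_zero]
    have hDle : D ≤ base.evenVirtualKernel := by
      rintro p hp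
      obtain ⟨v, hv, rfl⟩ := Submodule.mem_map.1 hp
      rw [memLt] at hv
      rw [mem_evenVirtualKernel_iff_of_negTwo_false base hd hμ]
      refine ⟨fun i => ?_, ?_, fun i => ?_⟩
      · simp only [LinearMap.prod_apply, LinearMap.id_coe]; exact h2 _
      · simp only [LinearMap.prod_apply, LinearMap.id_coe]; exact h2 _
      · simp only [LinearMap.prod_apply, LinearMap.id_coe]; exact hv i
    have hHD : H ⊓ D = ⊥ := by
      rw [Submodule.eq_bot_iff]
      intro p hp
      obtain ⟨hpH, hpD⟩ := Submodule.mem_inf.1 hp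
      obtain ⟨u, -, rfl⟩ := Submodule.mem_map.1 hpH
      obtain ⟨v, -, hv⟩ := Submodule.mem_map.1 hpD
      have h1 : v = u := by have := congrArg Prod.fst hv; simpa using this
      have h0 : v = 0 := by have := congrArg Prod.snd hv; simpa using this
      rw [← h1, h0]; rfl
    have hsum : finrank (ZMod 2) ↥(H ⊔ D) = finrank (ZMod 2) ↥H + finrank (ZMod 2) ↥D := by
      have := Submodule.finrank_sup_add_finrank_inf_eq H D
      rw [hHD, finrank_bot, add_zero] at this
      exact this
    have hHfin : finrank (ZMod 2) ↥H = finrank (ZMod 2) ↥(kerL ⊓ LinearMap.ker φ) :=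
      (LinearEquiv.finrank_eq (Submodule.equivMapOfInjective _ LinearMap.inl_injective _)).symm
    have hDfin : finrank (ZMod 2) ↥D = finrank (ZMod 2) ↥kerLt := by
      refine (LinearEquiv.finrank_eq (Submodule.equivMapOfInjective _ ?_ _)).symm
      intro a b hab
      exact congrArg Prod.fst hab
    -- `ker L ≤ (ker L ∩ ker φ) + ⟨1⟩`
    have hcod : finrank (ZMod 2) ↥kerL ≤ finrank (ZMod 2) ↥(kerL ⊓ LinearMap.ker φ) + 1 := by
      have hle : kerL ≤ (kerL ⊓ LinearMap.ker φ) ⊔ Submodule.span (ZMod 2) {fun _ => (1 : ZMod 2)} := by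
        intro y hy
        have hy1 : (fun _ => (1 : ZMod 2)) ∈ kerL := by
          rw [memL]; intro i; simp [h11]
        rw [Submodule.mem_sup]
        refine ⟨y - φ y • (fun _ => (1 : ZMod 2)), Submodule.mem_inf.2 ⟨?_, ?_⟩, φ y • (fun _ => (1 : ZMod 2)),
          Submodule.mem_span_singleton.2 ⟨φ y, rfl⟩, by abel⟩
        · exact kerL.sub_mem hy (kerL.smul_mem _ hy1)
        · rw [LinearMap.mem_ker, map_sub, map_smul, hφ1, smul_eq_mul, mul_one, sub_self]
      calc finrank (ZMod 2) ↥kerL ≤ finrank (ZMod 2) ↥((kerL ⊓ LinearMap.ker φ) ⊔ Submodule.span (ZMod 2) {fun _ => (1 : ZMod 2)}) :=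
            Submodule.finrank_mono hle
        _ ≤ finrank (ZMod 2) ↥(kerL ⊓ LinearMap.ker φ) + finrank (ZMod 2) ↥(Submodule.span (ZMod 2) {fun _ => (1 : ZMod 2)}) :=
            Submodule.finrank_add_le_finrank_add_finrank _ _
        _ ≤ finrank (ZMod 2) ↥(kerL ⊓ LinearMap.ker φ) + 1 := by
            have h1ne : (fun _ => (1 : ZMod 2)) ≠ (0 : Fin (k + 1) → ZMod 2) := by
              intro h; have := congrFun h 0; simp at this
            rw [finrank_span_singleton h1ne]
    have hle : finrank (ZMod 2) ↥(H ⊔ D) ≤ finrank (ZMod 2) ↥base.evenVirtualKernel := Submodule.finrank_mono (sup_le hHle hDle)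
    rw [hsum, hHfin, hDfin, hrank] at hle
    omega
  have htτ : t ≤ (finrank (ZMod 2) ↥base.evenVirtualKernel + 1) / 2 := by omega
  -- the design `δ = 1`
  set δ : Fin (k + 1) → ZMod 2 := fun _ => 1 with hδdef
  -- elements of the pencil
  have hpen : ∀ p : (Fin (k + 1) → ZMod 2) × (Fin (k + 1) → ZMod 2), p ∈ base.evenPencil δ →
      ∃ (u v : Fin (k + 1) → ZMod 2) (γ : ZMod 2),
        ((∀ i, (∑ j, bz (base.neg i j) * (u j + u i)) + ∑ j, bz (base.neg i j) * (v j + v i) = 0) ∧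
         ((∑ j, bz (negNegOne (base.cls j)) * u j) + ∑ j, bz (negNegOne (base.cls j)) * v j = 0) ∧
         (∀ i, (∑ j, bz (base.neg i j) * (v j + v i)) + bz (negNegOne (base.cls i)) * (∑ j, bz (negNegOne (base.cls j)) * v j) +
            bz (negNegOne (base.cls i)) * v i = 0)) ∧
        p = (fun b => v b + γ, fun b => u b) := by
    intro p hp
    obtain ⟨u, v, γ, hE1, hE2, rfl⟩ := (mem_evenPencil_iff base δ p).1 hp
    have hq := (mem_evenVirtualKernel_iff_of_negTwo_false base hd hμ (u, v)).1 ((mem_evenVirtualKernel_iff base (u, v)).2 ⟨hE1, hE2⟩)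
    refine ⟨u, v, γ, hq, ?_⟩
    refine Prod.ext ?_ ?_
    · funext b; simp [hδdef, h11]
    · funext b; simp [hδdef, h11]
  -- (hδ) legitimacy
  have hleg : ((δ, fun i => 1 + δ i) : (Fin (k + 1) → ZMod 2) × (Fin (k + 1) → ZMod 2)) ∉
      base.evenVirtualKernel.map (base.evenTwist δ) := by
    intro h
    obtain ⟨q, hq, hTq⟩ := Submodule.mem_map.1 h
    rw [evenTwist_apply] at hTq
    have hq1 : q.1 = 0 := by
      funext i; have := congrFun (congrArg Prod.snd hTq) i; simpa [hδdef, h11] using this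
    have hq2 : q.2 = fun _ => 1 := by
      funext i; have := congrFun (congrArg Prod.fst hTq) i; simpa [hδdef, h11, hq1] using this
    have hmem := (mem_evenVirtualKernel_iff_of_negTwo_false base hd hμ q).1 hq
    have := hmem.2.1
    rw [hq1, hq2] at this
    simp only [Pi.zero_apply, mul_zero, Finset.sum_const_zero, zero_add, mul_one] at this
    rw [hμ] at this
    exact one_ne_zero this
  -- (h1) the `V × 0` section lies in `ker L × 0`
  have hP1 : base.evenPencil δ ⊓ LinearMap.ker (LinearMap.snd (ZMod 2) (Fin (k + 1) → ZMod 2) (Fin (k + 1) → ZMod 2)) ≤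
      kerL.map (LinearMap.inl (ZMod 2) (Fin (k + 1) → ZMod 2) (Fin (k + 1) → ZMod 2)) := by
    intro p hp
    obtain ⟨hpW, hp0⟩ := Submodule.mem_inf.1 hp
    obtain ⟨u, v, γ, ⟨hL, hM, hT⟩, rfl⟩ := hpen p hpW
    rw [LinearMap.mem_ker, LinearMap.snd_apply] at hp0
    have hu : ∀ b, u b = 0 := fun b => congrFun hp0 b
    refine Submodule.mem_map.2 ⟨fun b => v b + γ, ?_, ?_⟩
    · rw [memL]; intro i
      have e := hL i
      simp only [hu, add_zero, mul_zero, Finset.sum_const_zero, zero_add] at e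
      rw [← e]; exact Finset.sum_congr rfl fun j _ => by linear_combination (bz (base.neg i j)) * h2 γ
    · refine Prod.ext rfl ?_
      funext b; simp [hu b]
  -- (h2) the `0 × V` section lies in `0 × ker L`
  have hP2 : base.evenPencil δ ⊓ LinearMap.ker (LinearMap.fst (ZMod 2) (Fin (k + 1) → ZMod 2) (Fin (k + 1) → ZMod 2)) ≤
      kerL.map (LinearMap.inr (ZMod 2) (Fin (k + 1) → ZMod 2) (Fin (k + 1) → ZMod 2)) := by
    intro p hp
    obtain ⟨hpW, hp0⟩ := Submodule.mem_inf.1 hp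
    obtain ⟨u, v, γ, ⟨hL, hM, hT⟩, rfl⟩ := hpen p hpW
    rw [LinearMap.mem_ker, LinearMap.fst_apply] at hp0
    have hv : ∀ b, v b = γ := fun b => by
      have := congrFun hp0 b; simp only [Pi.zero_apply] at this
      linear_combination this - h2 γ
    refine Submodule.mem_map.2 ⟨u, ?_, ?_⟩
    · rw [memL]; intro i
      have e := hL i
      simp only [hv, h2, mul_zero, Finset.sum_const_zero, add_zero] at e
      exact e
    · refine Prod.ext ?_ rfl
      funext b; simp [hv b, h2]
  -- (h3) the diagonal section lies in `{(v,v) : v ∈ ker Lᵀ}`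
  have hP3 : base.evenPencil δ ⊓ LinearMap.ker (LinearMap.fst (ZMod 2) (Fin (k + 1) → ZMod 2) (Fin (k + 1) → ZMod 2) +
      LinearMap.snd (ZMod 2) (Fin (k + 1) → ZMod 2) (Fin (k + 1) → ZMod 2)) ≤
      kerLt.map ((LinearMap.id : (Fin (k + 1) → ZMod 2) →ₗ[ZMod 2] (Fin (k + 1) → ZMod 2)).prod LinearMap.id) := by
    intro p hp
    obtain ⟨hpW, hp0⟩ := Submodule.mem_inf.1 hp
    obtain ⟨u, v, γ, ⟨hL, hM, hT⟩, rfl⟩ := hpen p hpW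
    rw [LinearMap.mem_ker, LinearMap.add_apply, LinearMap.fst_apply, LinearMap.snd_apply] at hp0
    have huv : ∀ b, u b = v b + γ := fun b => by
      have := congrFun hp0 b; simp only [Pi.add_apply, Pi.zero_apply] at this
      linear_combination this - h2 (v b) - h2 γ
    -- `γ = 0` from `⟨m, u+v⟩ = 0` and `μ = 1`
    have hγ : γ = 0 := by
      have e := hM
      simp only [huv] at e
      have : (∑ j, bz (negNegOne (base.cls j)) * (v j + γ)) + ∑ j, bz (negNegOne (base.cls j)) * v j =
          γ * ∑ b, bz (negNegOne (base.cls b)) := by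
        rw [Finset.mul_sum, ← Finset.sum_add_distrib]
        exact Finset.sum_congr rfl fun j _ => by linear_combination h2 (bz (negNegOne (base.cls j)) * v j)
      rw [this, hμ, mul_one] at e
      exact e
    refine Submodule.mem_map.2 ⟨v, ?_, ?_⟩
    · rw [memLt]; exact hT
    · refine Prod.ext ?_ ?_
      · funext b; simp [hγ]
      · funext b; simp [huv b, hγ]
  -- the three finrank bounds
  have hinjD : Function.Injective ((LinearMap.id : (Fin (k + 1) → ZMod 2) →ₗ[ZMod 2] (Fin (k + 1) → ZMod 2)).prod LinearMap.id) :=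
    fun a b hab => congrArg Prod.fst hab
  have b1 := (Submodule.finrank_mono hP1).trans
    (le_of_eq (LinearEquiv.finrank_eq (Submodule.equivMapOfInjective _ LinearMap.inl_injective kerL)).symm)
  have b2 := (Submodule.finrank_mono hP2).trans
    (le_of_eq (LinearEquiv.finrank_eq (Submodule.equivMapOfInjective _ LinearMap.inr_injective kerL)).symm)
  have b3 := (Submodule.finrank_mono hP3).trans
    (le_of_eq (LinearEquiv.finrank_eq (Submodule.equivMapOfInjective _ hinjD kerLt)).symm)
  rw [hrank] at b3
  exact exists_patternFree_even_design_pencil_of_odd base hμ δ hleg (b1.trans htτ) (b2.trans htτ) (b3.trans htτ)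

end NegTwoTrivial

end Summit.BirchSwinnertonDyer.BirchSwinnertonDyer.Theorems.SymbolicMonsky
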